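import Literature.NumberTheory.K2Lit.SiegelStandardSections
import Literature.NumberTheory.Automorphic.UnitaryGroupAdelicProduct
import HarnessLib

/-!
# STANDARD Iwasawa data for the doubled unitary group `H(𝔸) = U(𝕍 ⊕ −𝕍)(𝔸)`: the predicate `IwasawaDatum.IsStd`

Topic `NumberTheory/K2Lit` (Track B build stream 29; companion of leaf D1′ `SiegelStandardSections` — the Iwasawa INTERFACE `IwasawaDatum` — narrowing it to
the class print works with; cell `hodgecm-mathlib`, crux hLiu418 = stmt-HodgeConjecture-24832, LEAD F0P6-plan (g11) ruling «M-155j» (2026-09-04, memo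
`F0/P6/F0P6-plan-g11/RULING-M155j-S7-IwasawaStd.v1.F0P6-plan-g11.md` 0819a6799b3231ed), deal J1(a); seat `hodgecm-mathlib-K2Liu-p03` (g4)).
Definitions and proved lemmas only: **no `sorry`, no named fact, no instance, no notation.**

WHY.  ★ D1′ `K2Lit.SiegelDoubled.IwasawaDatum` is an INTERFACE: ANY compact subgroup `K ≤ H(𝔸)` with `H(𝔸) = P_Δ(𝔸)·K`.  The s23 ∕ s5 seam of the
tier-0 line (`DoublingZetaGL1` produces `∃ 𝒦 …`, `FirstTermThetaPairing` consumes `∀ 𝒦 …`) and the U6 sockets #41 ∕ #42R therefore range over EXOTIC data too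
(mixed archimedean∕finite subgroups; finite part not open; proper transitive compact subgroups at `∞`), for which «`K`-finite continuous section» is not the
printed notion and the SPAN ∕ first-term statements are of uncertain truth (census `K2/K2Liu-p03/g4/CENSUS-42S-Span…md` §S7).  Print never meets them: the
standard families of [Tan1999 §1], [HarrisKudlaSweet1996 (1.15)–(1.17)], [KudlaRallis1994 §1] are `K`-finite for `K = K_∞ · ∏_v K_v` with `K_v` OPEN compact
and `K_∞` the stabiliser of a positive majorant of the hermitian form (the classical maximal compact `U(n) × U(n)` of `U(n,n)`, [Weil1964 n° 8], [Shimura1997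
§A2]).  The ruling NARROWS both sides of the seam by ONE predicate threaded producer → consumer:

`IwasawaDatum.IsStd 𝒦` ⇔ there are a subgroup `C_∞ ≤ H_∞ = U(J^𝔻)(L ⊗ ℝ)` (★ `UnitaryGroup.arch`), a subgroup `C_f ≤ H(𝔸_f)` (★ `UnitaryGroup.finAdelic`) and
an archimedean frame `S ∈ GL_{2n}(L ⊗ ℝ)` such that
* (P0) PRODUCT: `k ∈ 𝒦.K ↔ k_∞ ∈ C_∞ ∧ k_f ∈ C_f` (★ `UnitaryGroup.archPart` ∕ `finPart`);
* (P1) OPEN FINITE PART: `C_f` is open in `H(𝔸_f)`;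
* (P2) ARCHIMEDEAN PART = THE STABILISER OF A MAJORANT: `C_∞ = {a ∈ H_∞ | S⁻¹ a S ∈ U(1)(L ⊗ ℝ)}` (★ `UnitaryGroup.arch … 1`, the compact unitary group of
  the identity form at every complex place), i.e. `C_∞ = H_∞ ∩ U(Q)` for the positive-definite `Q = (S S^*)⁻¹`, and `Q` MAJORISES `J^𝔻 ⊗ 1`: in the frame `S`
  the transported form `J′ = (σS)ᵀ (J^𝔻 ⊗ 1) S` satisfies `J′ · J′ = 1` (equivalently `(Q⁻¹J)² = 1`: `U(J^𝔻) ∩ U(Q)` is then a MAXIMAL compact subgroup,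
  conjugate to `U(n) × U(n)` placewise — the one the archimedean theory of `I_∞(s, χ)` is written for, [Lee1994], [GanQiuTakeda2014 Prop. 12]).
The tree's own datum (★ `K2LiuIwasawaDatumNonempty`: `K₉ = H ∩ S·(K_∞·GL_{2n}(𝒪̂_L))·S⁻¹` with `(σS)ᵀ J^𝔻 S = ` the antidiagonal unit form, whose square
is `1`) and its adapted level (★ `K2LiuIwasawaDatumAdapted`) are standard — deal J2 re-exports them WITH this shape; the sockets #41 ∕ #42R (U6 ED. 9), #33s
(U5d ED. 6) and tier-0 rev. l gain the binder `𝒦.IsStd` (J3 ∕ J5).  Consequences used downstream (deal J1(b),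
`Theorems/K2LiuIwasawaDatumStdSmooth`): (P1) ⇒ a continuous `𝒦.K`-finite section is right-invariant under an OPEN subgroup of `H(𝔸_f)` (no small subgroups in
`GL_m(ℂ)`); (P2) ⇒ «`K`-finite ⇒ `K_∞`-finite for a maximal compact of majorant type» holds by definition; (P0) lets the two halves be used separately.

API (unpacking only): `IsStd.exists_fin` (an open `C_f ≤ H(𝔸_f)` with `C_f ↪ 𝒦.K` along ★ `finAdelicToAdelic` and `finPart (𝒦.K) ≤ C_f`),
`IsStd.exists_arch` (the frame `S`, the majorant identity, and `archToAdelic (C_∞) ≤ 𝒦.K`, `archPart (𝒦.K) ≤ C_∞`), `IsStd.archToAdelic_mul_finAdelicToAdelic_mem`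
(`C_∞ · C_f ⊆ 𝒦.K` in `H(𝔸)`).
[cite: Tan1999, §1 p. 166] [cite: HarrisKudlaSweet1996, §1 (1.15)–(1.17)] [cite: KudlaRallis1994, §1] [cite: Weil1964, Chap. I n° 8] [cite: BorelJacquet1979, §4.1]
[cite: GanQiuTakeda2014, §5.6 Prop. 12]

## References
* [Tan1999] V. Tan, *Poles of Siegel Eisenstein series on U(n,n)*, Canad. J. Math. 51 (1999), §1 p. 166 (`K = K_∞ ∏ K_v`, standard sections).
* [HarrisKudlaSweet1996] M. Harris, S. Kudla, W. J. Sweet, J. AMS 9 (1996), §1 (1.15)–(1.17).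
* [KudlaRallis1994] S. Kudla, S. Rallis, Ann. of Math. 140 (1994), §1.
* [Weil1964] A. Weil, Acta Math. 111 (1964), Chap. I n° 8 (majorants ∕ the compact stabiliser).
* [BorelJacquet1979] A. Borel, H. Jacquet, Proc. Symp. Pure Math. 33.1 (1979), §4.1 (`G(𝔸) = G_∞ × G(𝔸_f)`, `K`-finiteness).
* [GanQiuTakeda2014] W. T. Gan, Y. Qiu, S. Takeda, Invent. Math. 198 (2014), §5.6 Prop. 12 (`K_∞`-types of `I_n^n(s, χ)`).

HONEST LABEL: HC_CM is proved only modulo the 7 printed citations (2 remaining named inputs: hLiu418 = stmt-HodgeConjecture-24832, h413 =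
stmt-HodgeConjecture-24833) until rung 0 closes; this file defines a predicate and moves no counter.
References: V. Tan, Canad. J. Math. 51 (1999) §1 [Tan1999]; M. Harris, S. Kudla, W. J. Sweet, JAMS 9 (1996) §1 [HarrisKudlaSweet1996]; A. Weil, Acta Math. 111 (1964) n° 8 [Weil1964].
-/

noncomputable section

open scoped Matrix
open NumberField NumberField.mixedEmbedding

namespace Literature.NumberTheory.K2Lit.SiegelDoubled

open Literature.NumberTheory.Automorphic Literature.NumberTheory.GaloisRepresentations
open Literature.NumberTheory.GelbartRogawski1991 Literature.NumberTheory.GelbartRogawski1991.GRConstruction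

variable {L : Type} [Field L] [NumberField L] [IsCMField L]
variable {N M n : ℕ} {e : Fin N × Fin M ≃ Fin n}
  {dV : Fin N → L} {hdV : ∀ i, IsCMField.complexConj L (dV i) = dV i}
  {dW : Fin M → L} {hdW : ∀ i, IsCMField.complexConj L (dW i) = dW i}

/-- **A STANDARD Iwasawa datum** (ruling «M-155j» (P0)–(P2)): `𝒦.K = C_∞ · C_f` is the PRODUCT of an archimedean subgroup `C_∞ ≤ H_∞` and a finite-adelic
subgroup `C_f ≤ H(𝔸_f)` (membership tested on the components ★ `archPart` ∕ `finPart`), with `C_f` OPEN in `H(𝔸_f)` and `C_∞ = H_∞ ∩ S·U(1)·S⁻¹` the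
stabiliser of the positive-definite MAJORANT `Q = (S S^*)⁻¹` of `J^𝔻 ⊗ 1` in an archimedean frame `S` (majorant identity `J′·J′ = 1` for the transported form
`J′ = (σS)ᵀ(J^𝔻 ⊗ 1)S`) — the class `K = K_∞·∏_v K_v` of print (dot notation `𝒦.IsStd`).
[cite: Tan1999, §1 p. 166] [cite: HarrisKudlaSweet1996, §1 (1.15)–(1.17)] [cite: Weil1964, Chap. I n° 8] [cite: BorelJacquet1979, §4.1] -/
def IwasawaDatum.IsStd (𝒦 : IwasawaDatum L e dV hdV dW hdW) : Prop :=
  ∃ (Cinf : Subgroup (UnitaryGroup.arch (Fp L) L (IsCMField.complexConj L) (n + n) (hermD L e dV hdV dW hdW)))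
    (Cfin : Subgroup (UnitaryGroup.finAdelic (Fp L) L (IsCMField.complexConj L) (n + n) (hermD L e dV hdV dW hdW)))
    (S : GL (Fin (n + n)) (mixedSpace L)),
    (∀ k : HA L e dV hdV dW hdW, k ∈ 𝒦.K ↔
      UnitaryGroup.archPart (Fp L) L (IsCMField.complexConj L) (n + n) (hermD L e dV hdV dW hdW) k ∈ Cinf ∧
        UnitaryGroup.finPart (Fp L) L (IsCMField.complexConj L) (n + n) (hermD L e dV hdV dW hdW) k ∈ Cfin) ∧
    IsOpen (Cfin : Set (UnitaryGroup.finAdelic (Fp L) L (IsCMField.complexConj L) (n + n) (hermD L e dV hdV dW hdW))) ∧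
    ((S : Matrix (Fin (n + n)) (Fin (n + n)) (mixedSpace L)).map (UnitaryGroup.conjMixed (Fp L) L (IsCMField.complexConj L)))ᵀ *
          UnitaryGroup.archFormOf L (n + n) (hermD L e dV hdV dW hdW) * (S : Matrix (Fin (n + n)) (Fin (n + n)) (mixedSpace L)) *
        (((S : Matrix (Fin (n + n)) (Fin (n + n)) (mixedSpace L)).map (UnitaryGroup.conjMixed (Fp L) L (IsCMField.complexConj L)))ᵀ *
          UnitaryGroup.archFormOf L (n + n) (hermD L e dV hdV dW hdW) * (S : Matrix (Fin (n + n)) (Fin (n + n)) (mixedSpace L))) = 1 ∧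
    ∀ a : UnitaryGroup.arch (Fp L) L (IsCMField.complexConj L) (n + n) (hermD L e dV hdV dW hdW),
      a ∈ Cinf ↔ S⁻¹ * (a : GL (Fin (n + n)) (mixedSpace L)) * S ∈
        UnitaryGroup.arch (Fp L) L (IsCMField.complexConj L) (n + n) (1 : Matrix (Fin (n + n)) (Fin (n + n)) L)

namespace IwasawaDatum.IsStd

variable {𝒦 : IwasawaDatum L e dV hdV dW hdW}

/-- **The finite half of a standard datum**: an OPEN subgroup `C_f ≤ H(𝔸_f)` whose image under `u ↦ (1, u)` (★ `finAdelicToAdelic`) lies in `𝒦.K` and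
which contains the finite component of every element of `𝒦.K` ((P0) + (P1); `(1,u)_∞ = 1 ∈ C_∞`, ★ `archPart_finAdelicToAdelic`).
[cite: BorelJacquet1979, §4.1] [cite: Tan1999, §1 p. 166] -/
theorem exists_fin (h : IwasawaDatum.IsStd 𝒦) :
    ∃ Cfin : Subgroup (UnitaryGroup.finAdelic (Fp L) L (IsCMField.complexConj L) (n + n) (hermD L e dV hdV dW hdW)),
      IsOpen (Cfin : Set (UnitaryGroup.finAdelic (Fp L) L (IsCMField.complexConj L) (n + n) (hermD L e dV hdV dW hdW))) ∧
      (∀ u ∈ Cfin, (UnitaryGroup.finAdelicToAdelic (Fp L) L (IsCMField.complexConj L) (n + n) (hermD L e dV hdV dW hdW) u :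
        HA L e dV hdV dW hdW) ∈ 𝒦.K) ∧
      ∀ k : HA L e dV hdV dW hdW, k ∈ 𝒦.K →
        UnitaryGroup.finPart (Fp L) L (IsCMField.complexConj L) (n + n) (hermD L e dV hdV dW hdW) k ∈ Cfin := by
  obtain ⟨Cinf, Cfin, S, hmem, hopen, -, -⟩ := h
  refine ⟨Cfin, hopen, fun u hu => (hmem _).2 ⟨?_, ?_⟩, fun k hk => ((hmem k).1 hk).2⟩
  · rw [UnitaryGroup.archPart_finAdelicToAdelic]
    exact Cinf.one_mem
  · rw [UnitaryGroup.finPart_finAdelicToAdelic]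
    exact hu

/-- **The archimedean half of a standard datum**: the frame `S` with the majorant identity `J′·J′ = 1`, the subgroup
`C_∞ = {a ∈ H_∞ | S⁻¹ a S ∈ U(1)}`, its image under `a ↦ (a, 1)` (★ `archToAdelic`) inside `𝒦.K`, and `(𝒦.K)_∞ ≤ C_∞` ((P0) + (P2)).
[cite: Weil1964, Chap. I n° 8] [cite: BorelJacquet1979, §4.1] -/
theorem exists_arch (h : IwasawaDatum.IsStd 𝒦) :
    ∃ (Cinf : Subgroup (UnitaryGroup.arch (Fp L) L (IsCMField.complexConj L) (n + n) (hermD L e dV hdV dW hdW)))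
      (S : GL (Fin (n + n)) (mixedSpace L)),
      ((S : Matrix (Fin (n + n)) (Fin (n + n)) (mixedSpace L)).map (UnitaryGroup.conjMixed (Fp L) L (IsCMField.complexConj L)))ᵀ *
            UnitaryGroup.archFormOf L (n + n) (hermD L e dV hdV dW hdW) * (S : Matrix (Fin (n + n)) (Fin (n + n)) (mixedSpace L)) *
          (((S : Matrix (Fin (n + n)) (Fin (n + n)) (mixedSpace L)).map (UnitaryGroup.conjMixed (Fp L) L (IsCMField.complexConj L)))ᵀ *
            UnitaryGroup.archFormOf L (n + n) (hermD L e dV hdV dW hdW) * (S : Matrix (Fin (n + n)) (Fin (n + n)) (mixedSpace L))) = 1 ∧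
      (∀ a : UnitaryGroup.arch (Fp L) L (IsCMField.complexConj L) (n + n) (hermD L e dV hdV dW hdW),
        a ∈ Cinf ↔ S⁻¹ * (a : GL (Fin (n + n)) (mixedSpace L)) * S ∈
          UnitaryGroup.arch (Fp L) L (IsCMField.complexConj L) (n + n) (1 : Matrix (Fin (n + n)) (Fin (n + n)) L)) ∧
      (∀ a ∈ Cinf, (UnitaryGroup.archToAdelic (Fp L) L (IsCMField.complexConj L) (n + n) (hermD L e dV hdV dW hdW) a :
        HA L e dV hdV dW hdW) ∈ 𝒦.K) ∧
      ∀ k : HA L e dV hdV dW hdW, k ∈ 𝒦.K →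
        UnitaryGroup.archPart (Fp L) L (IsCMField.complexConj L) (n + n) (hermD L e dV hdV dW hdW) k ∈ Cinf := by
  obtain ⟨Cinf, Cfin, S, hmem, -, hmaj, harch⟩ := h
  refine ⟨Cinf, S, hmaj, harch, fun a ha => (hmem _).2 ⟨?_, ?_⟩, fun k hk => ((hmem k).1 hk).1⟩
  · rw [UnitaryGroup.archPart_archToAdelic]
    exact ha
  · rw [UnitaryGroup.finPart_archToAdelic]
    exact Cfin.one_mem

/-- **Product**: for a standard datum, `(a, 1)·(1, u) ∈ 𝒦.K` whenever `a` is in the archimedean part and `u` in the finite part of SOME element of `𝒦.K`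
each — in particular `𝒦.K = (𝒦.K)_∞ · (𝒦.K)_f` (every `k` is `(k_∞,1)·(1,k_f)`, ★ `archToAdelic_mul_finAdelicToAdelic`). [cite: BorelJacquet1979, §4.1] -/
theorem archToAdelic_mul_finAdelicToAdelic_mem (h : IwasawaDatum.IsStd 𝒦) {k k' : HA L e dV hdV dW hdW} (hk : k ∈ 𝒦.K) (hk' : k' ∈ 𝒦.K) :
    (UnitaryGroup.archToAdelic (Fp L) L (IsCMField.complexConj L) (n + n) (hermD L e dV hdV dW hdW)
          (UnitaryGroup.archPart (Fp L) L (IsCMField.complexConj L) (n + n) (hermD L e dV hdV dW hdW) k) *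
        UnitaryGroup.finAdelicToAdelic (Fp L) L (IsCMField.complexConj L) (n + n) (hermD L e dV hdV dW hdW)
          (UnitaryGroup.finPart (Fp L) L (IsCMField.complexConj L) (n + n) (hermD L e dV hdV dW hdW) k') : HA L e dV hdV dW hdW) ∈ 𝒦.K := by
  obtain ⟨Cinf, Cfin, S, hmem, -, -, -⟩ := h
  refine (hmem _).2 ⟨?_, ?_⟩
  · rw [map_mul, UnitaryGroup.archPart_archToAdelic, UnitaryGroup.archPart_finAdelicToAdelic, mul_one]
    exact ((hmem k).1 hk).1
  · rw [map_mul, UnitaryGroup.finPart_archToAdelic, UnitaryGroup.finPart_finAdelicToAdelic, one_mul]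
    exact ((hmem k').1 hk').2

end IwasawaDatum.IsStd

end Literature.NumberTheory.K2Lit.SiegelDoubled

end
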